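import Summits.CriticalPhenomena.CardyFormulaZ2.Theses.CardySelfDualSegment
import Summits.CriticalPhenomena.CardyFormulaZ2.Theorems.CardySelfDualSegmentUniformBoxCrossingOfMonotoneChirality
import Summits.CriticalPhenomena.CardyFormulaZ2.Theorems.CardySelfDualSegmentUniformBoxCrossingStubBinomial
import Summits.CriticalPhenomena.CardyFormulaZ2.Theorems.CardySelfDualSegmentUniformBoxCrossingStubTilt
import Summits.CriticalPhenomena.CardyFormulaZ2.Theorems.CardySelfDualSegmentUniformBoxCrossingStubLocal
import HarnessLib

/-!
# `UniformBoxCrossing` from microcanonical monotonicity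
(stmt-CriticalPhenomena-5476, line `Sketch` v4, continuation lead c6, 2026-08-17)

The conditional form of the reshaped line (the microcanonical composition). Write
`M_t = cornerPercolation t` for the corner family and, for an event `E` of a finite box with
vertex (corner) set `F`, `N_k(E) := 2^{|F|} · M_1(E ∩ {exactly k corners of F disagree})` (a corner
`v` disagrees when exactly one of its two edges `{v, v+e₁}`, `{v, v+e₂}` is open) and
`φ̄_k(E) := N_k(E) / C(|F|, k)`, the MICROCANONICAL PROFILE of `E` under critical bond percolation
`M_1 = P_{1/2}` (`cornerPercolation_one`). The landed tilt identity (`stub_tilt`, p156036) says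
`M_t(E) = Σ_k (t/2)^k (1 - t/2)^{|F|-k} N_k(E) = E_{K ∼ Bin(|F|, t/2)} φ̄_K(E)`.

* `endpointDominationU_of_microcanonicalU`: if the profile of the hard-way u-crossing `U` of the
  turned `m × 2m` boxes is non-decreasing in `k` (eventually in `m`), then `M_0(U) ≤ M_t(U)` for
  all `t ∈ [0,1]` — the u-half of ENDPOINT DOMINATION (child `EndpointDominationU` of the planners'
  split package), by `stub_binomial` (i) (p155271) and `stub_local` (p156413);
* `endpointDominationW_of_microcanonicalW`: if the profile of the hard-way w-crossing `W` of the
  turned `2m × m` boxes is non-increasing, then `M_1(W) ≤ M_t(W)` (child `EndpointDominationW`),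
  by `stub_binomial` (ii): `s ↦ E_{Bin(|F|,s)} φ̄_K` is non-increasing on `[0,1]` and `t/2 ≤ 1/2`;
* `uniformBoxCrossing_of_microcanonical`: both monotonicities give the crux, through the landed
  `uniformBoxCrossing_of_endpointDomination` (p139614).

The two hypotheses are statements about ONE measure (critical bond-`ℤ²`), finite for each `m`
("among the configurations of the box with exactly `k` disagreeing NE-corners, the fraction with a
hard-way u-crossing grows with `k`, the fraction with a hard-way w-crossing decreases"); they are
exact for `m ≤ 3` (KERNEL-DOSSIER-c4 §2b, c5 §1.2) and imply monotone chirality on the whole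
extended family `t ∈ [0,2]`. They are the registered kernel stubs `stub_microcanonicalU/W` of
`Cruxes/UniformBoxCrossing/Lines/Sketch.lean` (v4); this file is the line's composition with the
kernel abstracted as hypotheses.
-/

namespace Summit.CriticalPhenomena.CardyFormulaZ2.Cruxes.UniformBoxCrossing.Microcanonical

open MeasureTheory Complex Literature.Probability.Percolation Literature.Probability.LatticeModels
open Literature.Probability.Percolation.TrackExchange
open Summit.CriticalPhenomena.CardyFormulaZ2.Theses.CardySelfDualSegment
open Summit.CriticalPhenomena.CardyFormulaZ2.Cruxes.UniformBoxCrossing.NonSlantLine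

/-- Coercion bookkeeping: `t/2 ∈ [0, 1]` for `t ∈ [0,1]`. -/
private theorem half_coe_mem' (t : unitInterval) : 0 ≤ (t : ℝ) / 2 ∧ (t : ℝ) / 2 ≤ 1 := by
  obtain ⟨h0, h1⟩ := t.2
  constructor <;> linarith

/-- **Endpoint domination, u-half, from microcanonical monotonicity.** If, eventually in `m`, for
every turned `m × 2m` u-box `U` at `(A, B)` with vertex set `F`, the microcanonical profile
`k ↦ φ̄_k(U) = N_k(U)/C(|F|,k)` is non-decreasing (cross-multiplied form), then
`M_0(U) ≤ M_t(U)` for every `t ∈ [0,1]`: by the tilt identity `M_t(U) = E_{Bin(|F|,t/2)} φ̄_K`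
and `M_0(U) = φ̄_0`, and a binomial mixture of a non-decreasing profile is at least its value at
`0` (`stub_binomial` (i)). This is the u-child `EndpointDominationU` of the split package. -/
theorem endpointDominationU_of_microcanonicalU
    (hMM : ∃ m₁ : ℕ, ∀ m : ℕ, m₁ ≤ m → ∀ (A B : ℤ) (F : Finset (Site 2)),
      (↑F = {v : Site 2 | A ≤ col v ∧ col v ≤ A + m ∧ B - 2 ≤ hgtOf v ∧ hgtOf v ≤ B + 2 * m + 2}) →
      ∀ k : ℕ, k + 1 ≤ F.card →
        2 ^ F.card * (cornerPercolation 1).real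
            (embTBCrossing (fun v => zDia v - ((A : ℂ) + (B : ℂ) * I)) m (2 * m) ∩
              {ω | Set.ncard {v : Site 2 | v ∈ (↑F : Set (Site 2)) ∧
                Xor (cornerEdge (v, 0) ∈ ω) (cornerEdge (v, 1) ∈ ω)} = k}) *
          (F.card.choose (k + 1) : ℝ) ≤
        2 ^ F.card * (cornerPercolation 1).real
            (embTBCrossing (fun v => zDia v - ((A : ℂ) + (B : ℂ) * I)) m (2 * m) ∩
              {ω | Set.ncard {v : Site 2 | v ∈ (↑F : Set (Site 2)) ∧
                Xor (cornerEdge (v, 0) ∈ ω) (cornerEdge (v, 1) ∈ ω)} = k + 1}) *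
          (F.card.choose k : ℝ)) :
    ∃ m₁ : ℕ, ∀ m : ℕ, m₁ ≤ m → ∀ (A B : ℤ) (t : unitInterval),
      (cornerPercolation 0).real (embTBCrossing (fun v => zDia v - ((A : ℂ) + (B : ℂ) * I)) m (2 * m)) ≤
        (cornerPercolation t).real (embTBCrossing (fun v => zDia v - ((A : ℂ) + (B : ℂ) * I)) m (2 * m)) := by
  obtain ⟨m₁, hMM⟩ := hMM
  refine ⟨m₁, fun m hm A B t => ?_⟩
  obtain ⟨hfin, hmeas, hdet⟩ := stub_local.1 A B m
  set U := embTBCrossing (fun v => zDia v - ((A : ℂ) + (B : ℂ) * I)) m (2 * m) with hU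
  set F : Finset (Site 2) := hfin.toFinset with hFdef
  have hF : (↑F : Set (Site 2)) =
      {v : Site 2 | A ≤ col v ∧ col v ≤ A + m ∧ B - 2 ≤ hgtOf v ∧ hgtOf v ≤ B + 2 * m + 2} :=
    hfin.coe_toFinset
  have hdet' : DeterminedBy {S : Set (Site 2 × Fin 2) | cornerConfig S ∈ U}
      ↑(F ×ˢ (Finset.univ : Finset (Fin 2))) := by
    rw [Finset.coe_product, Finset.coe_univ, hF]; exact hdet
  set N : ℕ → ℝ := fun k => 2 ^ F.card * (cornerPercolation 1).real
      (U ∩ {ω | Set.ncard {v : Site 2 | v ∈ (↑F : Set (Site 2)) ∧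
        Xor (cornerEdge (v, 0) ∈ ω) (cornerEdge (v, 1) ∈ ω)} = k}) with hN
  have hN0 : ∀ k, 0 ≤ N k := fun k => mul_nonneg (pow_nonneg zero_le_two _) measureReal_nonneg
  have hmono : ∀ k, k + 1 ≤ F.card →
      N k * (F.card.choose (k + 1) : ℝ) ≤ N (k + 1) * (F.card.choose k : ℝ) :=
    fun k hk => hMM m hm A B F hF k hk
  have ht : (cornerPercolation t).real U =
      ∑ k ∈ Finset.range (F.card + 1), ((t : ℝ) / 2) ^ k * (1 - (t : ℝ) / 2) ^ (F.card - k) * N k := by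
    rw [stub_tilt t F U hmeas hdet', Finset.mul_sum]
    refine Finset.sum_congr rfl fun k _ => ?_
    simp only [hN]; ring
  have h0 : (cornerPercolation 0).real U = N 0 := by
    rw [stub_tilt 0 F U hmeas hdet', Finset.mul_sum]
    rw [Finset.sum_eq_single 0]
    · simp [hN]
    · intro k _ hk
      simp [zero_pow hk]
    · intro h; simp at h
  rw [h0, ht]
  exact stub_binomial.1 F.card N hN0 hmono ((t : ℝ) / 2) (half_coe_mem' t).1 (half_coe_mem' t).2

/-- **Endpoint domination, w-half, from microcanonical monotonicity.** If, eventually in `m`, for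
every turned `2m × m` w-box `W` at `(A, B)` with vertex set `F`, the microcanonical profile
`k ↦ φ̄_k(W)` is non-increasing (cross-multiplied form), then `M_1(W) ≤ M_t(W)` for every
`t ∈ [0,1]`: `M_t(W) = f(t/2)` with `f(s) = E_{Bin(|F|,s)} φ̄_K` non-increasing on `[0,1]`
(`stub_binomial` (ii)), `t/2 ≤ 1/2` and `f(1/2) = M_1(W)`. This is the w-child
`EndpointDominationW` of the split package. -/
theorem endpointDominationW_of_microcanonicalW
    (hMM : ∃ m₁ : ℕ, ∀ m : ℕ, m₁ ≤ m → ∀ (A B : ℤ) (F : Finset (Site 2)),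
      (↑F = {v : Site 2 | A - 2 ≤ col v ∧ col v ≤ A + 2 * m + 2 ∧ B ≤ hgtOf v ∧ hgtOf v ≤ B + m}) →
      ∀ k : ℕ, k + 1 ≤ F.card →
        2 ^ F.card * (cornerPercolation 1).real
            (embRectCrossing (fun v => zDia v - ((A : ℂ) + (B : ℂ) * I)) (2 * m) m ∩
              {ω | Set.ncard {v : Site 2 | v ∈ (↑F : Set (Site 2)) ∧
                Xor (cornerEdge (v, 0) ∈ ω) (cornerEdge (v, 1) ∈ ω)} = k + 1}) *
          (F.card.choose k : ℝ) ≤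
        2 ^ F.card * (cornerPercolation 1).real
            (embRectCrossing (fun v => zDia v - ((A : ℂ) + (B : ℂ) * I)) (2 * m) m ∩
              {ω | Set.ncard {v : Site 2 | v ∈ (↑F : Set (Site 2)) ∧
                Xor (cornerEdge (v, 0) ∈ ω) (cornerEdge (v, 1) ∈ ω)} = k}) *
          (F.card.choose (k + 1) : ℝ)) :
    ∃ m₁ : ℕ, ∀ m : ℕ, m₁ ≤ m → ∀ (A B : ℤ) (t : unitInterval),
      (cornerPercolation 1).real (embRectCrossing (fun v => zDia v - ((A : ℂ) + (B : ℂ) * I)) (2 * m) m) ≤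
        (cornerPercolation t).real (embRectCrossing (fun v => zDia v - ((A : ℂ) + (B : ℂ) * I)) (2 * m) m) := by
  obtain ⟨m₁, hMM⟩ := hMM
  refine ⟨m₁, fun m hm A B t => ?_⟩
  obtain ⟨hfin, hmeas, hdet⟩ := stub_local.2 A B m
  set W := embRectCrossing (fun v => zDia v - ((A : ℂ) + (B : ℂ) * I)) (2 * m) m with hW
  set F : Finset (Site 2) := hfin.toFinset with hFdef
  have hF : (↑F : Set (Site 2)) =
      {v : Site 2 | A - 2 ≤ col v ∧ col v ≤ A + 2 * m + 2 ∧ B ≤ hgtOf v ∧ hgtOf v ≤ B + m} :=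
    hfin.coe_toFinset
  have hdet' : DeterminedBy {S : Set (Site 2 × Fin 2) | cornerConfig S ∈ W}
      ↑(F ×ˢ (Finset.univ : Finset (Fin 2))) := by
    rw [Finset.coe_product, Finset.coe_univ, hF]; exact hdet
  set N : ℕ → ℝ := fun k => 2 ^ F.card * (cornerPercolation 1).real
      (W ∩ {ω | Set.ncard {v : Site 2 | v ∈ (↑F : Set (Site 2)) ∧
        Xor (cornerEdge (v, 0) ∈ ω) (cornerEdge (v, 1) ∈ ω)} = k}) with hN
  have hN0 : ∀ k, 0 ≤ N k := fun k => mul_nonneg (pow_nonneg zero_le_two _) measureReal_nonneg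
  have hmono : ∀ k, k + 1 ≤ F.card →
      N (k + 1) * (F.card.choose k : ℝ) ≤ N k * (F.card.choose (k + 1) : ℝ) :=
    fun k hk => hMM m hm A B F hF k hk
  have hf : ∀ u : unitInterval, (cornerPercolation u).real W =
      ∑ k ∈ Finset.range (F.card + 1), ((u : ℝ) / 2) ^ k * (1 - (u : ℝ) / 2) ^ (F.card - k) * N k := by
    intro u
    rw [stub_tilt u F W hmeas hdet', Finset.mul_sum]
    refine Finset.sum_congr rfl fun k _ => ?_
    simp only [hN]; ring
  have hanti := stub_binomial.2 F.card N hN0 hmono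
  rw [hf 1, hf t]
  have h1 : ((1 : unitInterval) : ℝ) / 2 = 1 / 2 := by simp
  rw [h1]
  refine hanti ⟨(half_coe_mem' t).1, (half_coe_mem' t).2⟩ ⟨by norm_num, by norm_num⟩ ?_
  have := t.2.2
  linarith

/-- **`UniformBoxCrossing` from microcanonical monotonicity** (the composition of line `Sketch`
v4 with its kernel as hypotheses): the two microcanonical monotonicities give the two halves of
endpoint domination, and the landed chain `uniformBoxCrossing_of_endpointDomination` (p139614:
endpoint RSW inputs at `t = 0` (site-`𝕋`) and `t = 1` (bond-`ℤ²`), chaining, zig-zag, and the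
Bollobás–Riordan tail) gives the t-uniform box-crossing bounds. -/
theorem uniformBoxCrossing_of_microcanonical : (∃ m₁ : ℕ, ∀ m : ℕ, m₁ ≤ m → ∀ (A B : ℤ) (F : Finset (Literature.Probability.LatticeModels.Site 2)), (↑F = {v : Literature.Probability.LatticeModels.Site 2 | A ≤ Literature.Probability.Percolation.TrackExchange.col v ∧ Literature.Probability.Percolation.TrackExchange.col v ≤ A + m ∧ B - 2 ≤ Literature.Probability.Percolation.TrackExchange.hgtOf v ∧ Literature.Probability.Percolation.TrackExchange.hgtOf v ≤ B + 2 * m + 2}) → ∀ k : ℕ, k + 1 ≤ F.card → 2 ^ F.card * (Literature.Probability.Percolation.cornerPercolation 1).real (Literature.Probability.LatticeModels.embTBCrossing (fun v => Literature.Probability.Percolation.TrackExchange.zDia v - ((A : ℂ) + (B : ℂ) * Complex.I)) m (2 * m) ∩ {ω | Set.ncard {v : Literature.Probability.LatticeModels.Site 2 | v ∈ (↑F : Set (Literature.Probability.LatticeModels.Site 2)) ∧ Xor (Literature.Probability.Percolation.cornerEdge (v, 0) ∈ ω) (Literature.Probability.Percolation.cornerEdge (v, 1) ∈ ω)} = k})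 * (F.card.choose (k + 1) : ℝ) ≤ 2 ^ F.card * (Literature.Probability.Percolation.cornerPercolation 1).real (Literature.Probability.LatticeModels.embTBCrossing (fun v => Literature.Probability.Percolation.TrackExchange.zDia v - ((A : ℂ) + (B : ℂ) * Complex.I)) m (2 * m) ∩ {ω | Set.ncard {v : Literature.Probability.LatticeModels.Site 2 | v ∈ (↑F : Set (Literature.Probability.LatticeModels.Site 2)) ∧ Xor (Literature.Probability.Percolation.cornerEdge (v, 0) ∈ ω) (Literature.Probability.Percolation.cornerEdge (v, 1) ∈ ω)} = k + 1}) * (F.card.choose k : ℝ)) → (∃ m₁ : ℕ, ∀ m : ℕ, m₁ ≤ m → ∀ (A B : ℤ) (F : Finset (Literature.Probability.LatticeModels.Site 2)), (↑F = {v : Literature.Probability.LatticeModels.Site 2 | A - 2 ≤ Literature.Probability.Percolation.TrackExchange.col v ∧ Literature.Probability.Percolation.TrackExchange.col v ≤ A + 2 * m + 2 ∧ B ≤ Literature.Probability.Percolation.TrackExchange.hgtOf v ∧ Literature.Probability.Percolation.TrackExchange.hgtOf v ≤ B + m}) → ∀ k : ℕ, k + 1 ≤ F.card → 2 ^ F.card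 * (Literature.Probability.Percolation.cornerPercolation 1).real (Literature.Probability.LatticeModels.embRectCrossing (fun v => Literature.Probability.Percolation.TrackExchange.zDia v - ((A : ℂ) + (B : ℂ) * Complex.I)) (2 * m) m ∩ {ω | Set.ncard {v : Literature.Probability.LatticeModels.Site 2 | v ∈ (↑F : Set (Literature.Probability.LatticeModels.Site 2)) ∧ Xor (Literature.Probability.Percolation.cornerEdge (v, 0) ∈ ω) (Literature.Probability.Percolation.cornerEdge (v, 1) ∈ ω)} = k + 1}) * (F.card.choose k : ℝ) ≤ 2 ^ F.card * (Literature.Probability.Percolation.cornerPercolation 1).real (Literature.Probability.LatticeModels.embRectCrossing (fun v => Literature.Probability.Percolation.TrackExchange.zDia v - ((A : ℂ) + (B : ℂ) * Complex.I)) (2 * m) m ∩ {ω | Set.ncard {v : Literature.Probability.LatticeModels.Site 2 | v ∈ (↑F : Set (Literature.Probability.LatticeModels.Site 2)) ∧ Xor (Literature.Probability.Percolation.cornerEdge (v, 0) ∈ ω) (Literature.Probability.Percolation.cornerEdge (v, 1) ∈ ω)} = k}) * (F.card.choose (k + 1) : ℝ)) → Summit.CriticalPhenomena.CardyFormulaZ2.Theses.CardySelfDualSegment.UniformBoxCrossing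 := by
  intro hU hW
  obtain ⟨m₁, hU'⟩ := endpointDominationU_of_microcanonicalU hU
  obtain ⟨m₂, hW'⟩ := endpointDominationW_of_microcanonicalW hW
  exact uniformBoxCrossing_of_endpointDomination ⟨max m₁ m₂, fun m hm A B t =>
    ⟨hU' m ((le_max_left _ _).trans hm) A B t, hW' m ((le_max_right _ _).trans hm) A B t⟩⟩

end Summit.CriticalPhenomena.CardyFormulaZ2.Cruxes.UniformBoxCrossing.Microcanonical
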